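import Summits.AnomalousDissipation.AnomalousDissipation.Theses.StirringSphere

/-!
# Crux `NoScreening` (stmt-AnomalousDissipation-17144, route StirringSphere, rank 2) — birth skeleton

`Lines/birth.lean`: the ENERGISED × COHERENT factorisation of the crux. Two named stubs and the
kernel-checked composition `NoScreening_of : stub₁ → stub₂ → NoScreening` (hypotheses = the name-keyed
aliases `__Registered.stub_*` of the two stub signatures, see § aliases; wiring `example` at the end),
concluding the route decl
`Summit.AnomalousDissipation.AnomalousDissipation.Theses.StirringSphere.NoScreening` BY NAME; sorries only
inside the two `stub_*`.

## The crux

On the stirring sphere `f_c = Σ cᵢ bᵢ`, `‖c‖ = 1` (the explicit triple `b = ![b₀, b₁, b₂]` of the route file,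
repeated verbatim in the binders below), write `Y(u) := ((u, bᵢ))_{i<3} ∈ ℝ³` for the STIRRED-MODE COORDINATES
of a state `u ∈ H` and, for a Foias–Prodi stationary statistical solution `μ` of `NS_ν(f_c)`,
`y(μ) := ∫ Y dμ` (mean-flow response, the vector of the crux) and `e(μ) := ∫ |Y|² dμ` (stirred-mode energy;
`= (3/2)·∫‖Π_V u‖² dμ`, `V = span(b₀,b₁,b₂)`, since the `bᵢ` are orthogonal with `‖bᵢ‖² = 3/2`). The crux
asks `|y(μ)|² ≥ m₀(E)² > 0` for every bounded (`∫‖u‖² dμ ≤ E`) stationary statistics, uniformly over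
`c ∈ S²` and `ν ∈ (0, ν₀(E))`. Known structure (grounder notes on the item; FMRT IV (1.31) = tree theorem
`Literature.Analysis.FluidPDE.Torus.IsStationaryStatisticalSolution.energy_le_holds`): the RADIAL component is
the ensemble injection, `c·y(μ) = ∫ (u, f_c) dμ = P(μ) ≥ ν·⟨enstrophy⟩ = D(μ) ≥ 0`, so `|y| ≥ P ≥ D` and
non-vanishing is automatic at each fixed `ν > 0`; the whole content is the ν-UNIFORMITY.

## The cut (why these two stubs)

`|∫ Y dμ|² ≥ m₀²` factors through the second moment: `|∫Y dμ|² = (|∫Y dμ|² / ∫|Y|² dμ) · ∫|Y|² dμ`. The two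
factors fail for physically DIFFERENT reasons, and each is a statement of independent standing:

* `stub_stirredModesEnergised` — NO DEPLETION (the cascade half; size XL, open): the stirred modes keep a
  ν-uniform share of energy, `e(μ) ≥ η(E) > 0`. Since `(u, f_c) = c·Y(u)` and `|c| = 1`, Jensen gives
  `e(μ) ≥ P(μ)² ≥ D(μ)²`: the stub follows from ANY ν-uniform injection or dissipation floor on the sphere
  (the ensemble zeroth law in Kolmogorov's form — the energy-containing range sits at the forcing scale), and
  from the crux itself (`|∫Y|² ≤ ∫|Y|²`); it is the weakest unknown consequence in the chain. Failure mode: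
  a bounded QUIET statistics whose Reynolds stress drains `b₀, b₁, b₂` as fast as `f_c` pushes them
  (`P, D, e → 0`), the energy parked in a condensate on `V^⊥` (the nine other shell-1 Stokes modes) — the
  crux's recorded why-might-fail, isolated in its weakest form.
* `stub_stirredModesCoherent` — NO STATISTICAL REVERSAL (the symmetry-breaking half; size XL, open): the mean
  captures a fixed fraction of the stirred-mode energy, `|y(μ)|² ≥ κ(E)·e(μ)`, a scale-free order parameter
  `|⟨Y⟩|²/⟨|Y|²⟩ ≥ κ`, uniformly on the sphere at small `ν`. Plausible because the sphere admits NO symmetry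
  reversing `V` (no isometry `g` of `T³` with `g·bᵢ = −bᵢ ∀ i` fixes any `f_c` — route header, cheapest
  falsifier (a)), and the steady force accelerates the `c`-coordinate of `Y` at the constant rate
  `‖f_c‖² = 3/2` (`d/dt (u,f_c) = ‖f_c‖² − ν(u, A f_c) − b(u,u,f_c)`), so a sign-symmetric law of `Y` needs
  the nonlinear transfer to overpower a steady push symmetrically in both directions; the documented
  large-scale reversals under steady forcing (periodic Kolmogorov flow, MusacchioBoffetta2014) flip a
  TRANSVERSE mode whose mean vanishes by symmetry, never the forced coordinate. Failure mode: slow vacillation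
  between two mirror-imbalanced large-scale states with equal weights; bounded energy gives no pointwise
  control of `b(u,u,f_c)`. The crux implies it too (`κ = 2m₀²/(9E)`, as `e(μ) ≤ (9/2)·∫‖u‖² dμ`).

So `NoScreening ⟺ stub₁ ∧ stub₂` (neither direction by `exact?`/`simpa`/`aesop`: each needs an integral
inequality), and NEITHER STUB ALONE GIVES THE CRUX: stub₁ allows energised but incoherent shells (`y = 0`,
reversals), stub₂ allows coherent but depleted shells (`e → 0`, hence `y → 0`). Composition
(`NoScreening_of`, no sorry): `ν₀ := min ν₁ ν₂`, `m₀ := √(κη)`, and `m₀² = κη ≤ κ·e(μ) ≤ |y(μ)|²`.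

Cuts considered and rejected (planner census, NOTES.md of the registrar seat): (a) FLOOR line (ν-uniform
injection/dissipation floor on the sphere ⟹ crux): a single stub STRONGER than the crux which moots the route's
hairy-ball mechanism (every force of the sphere would be loud), plus a bookkeeping stub; (b) radial/tangential
("loud or rotated") dichotomies: equivalent restatements; (c) inviscid limit + Liouville on the
finite-dimensional `V`-shadow: the limit identities on `V` carry no obstruction (`τ* := −(3/2)c*ρ*` solves
them) and the naive relaxed Euler–Reynolds class contains the zero-velocity stress-balanced state
`σ₀ = sym∇Δ⁻¹f_c + K·I ⪰ 0`, so no honest Liouville stub exists in tree vocabulary; (d) splits by regions of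
the sphere: rejected by the route planner (the sphere is indivisible for the topology).

Disproof used: none relevant (no `Disproof.lean`, no `Negative/` lemma, no crux ideas exist for this crux at
registration: `ledger crux ls stmt-AnomalousDissipation-17144` → no workfiles). Negatives index of the summit:
the refuted ANY-MEAN energy statements (GPEnergyCeiling, EnsembleCeilingBridge) are dodged as in the route —
both stubs quantify over statistics on the mean-zero space `H` and claim no energy ceiling.

Hardest stub: `stub_stirredModesCoherent` (a ν-uniform statistical symmetry breaking for which no mechanism is
in print; `stub_stirredModesEnergised` is downstream of every floor-type route on the ledger and of K41).
Sources: FMRTTurbulence2001 Ch. IV §1.2 (1.29)–(1.34), Ch. V §1; DoeringFoias2002 §2; Frisch1995 §5.2, §6.1,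
§7.5; MusacchioBoffetta2014; KanedaEtAl2003; Cheskidov2023 = arXiv:2311.04182 §1.2.
-/

-- `Summit.<Summit>.<Problem>` is the tree's mandated summit-side namespace (CONVENTIONS §2); for this
-- single-conjunct summit the two coincide, so the duplicate is deliberate.
set_option linter.dupNamespace false

noncomputable section

open MeasureTheory
open scoped BigOperators

namespace Summit.AnomalousDissipation.AnomalousDissipation.Cruxes.NoScreening.Birth

/-- **stub 1 — the stirred modes stay energised (no depletion; the cascade half; size XL, open).**
For every energy level `E > 0` there are `ν₁, η > 0` such that for every unit `c`, every `ν ∈ (0, ν₁)` and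
every Foias–Prodi stationary statistical solution `μ` of `NS_ν(f_c)`, `f_c = Σ cᵢ bᵢ`, with integrable energy
`∫‖u‖² dμ ≤ E`, the stirred-mode energy is bounded below: `∫ Σᵢ (u, bᵢ)² dμ ≥ η`. Why plausibly true:
`∫ Σᵢ (u,bᵢ)² dμ ≥ (∫ (u,f_c) dμ)² = P(μ)² ≥ D(μ)²` (Jensen, `|c| = 1`; FMRT IV (1.31) =
`IsStationaryStatisticalSolution.energy_le_holds`), so it follows from any ν-uniform injection or dissipation
floor on the sphere and from K41 (energy-containing range at the forcing scale); at each fixed `ν > 0` the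
quantity is positive (`e = 0 ⟹ P = 0 ⟹ D = 0 ⟹ μ = δ₀`, which is not stationary for `f_c ≠ 0`). Why it
might fail: a bounded quiet statistics draining `b₀,b₁,b₂` by Reynolds stress with its energy condensed on
`V^⊥`. Leans on: `IsStationaryStatisticalSolution.energy_le_holds`, `.integrable_pairing`, `.ae_norm_le`
(tree); FMRTTurbulence2001 Ch. IV–V; DoeringFoias2002 §2; Frisch1995 §7.5. -/
theorem stub_stirredModesEnergised :
    ∀ b : Fin 3 → UnitAddTorus (Fin 3) → EuclideanSpace ℝ (Fin 3), b = ![(fun x : UnitAddTorus (Fin 3) => (Literature.Analysis.FluidPDE.Torus.stokesMode (Pi.single (2 : Fin 3) (1 : ℤ)) (EuclideanSpace.single (0 : Fin 3) (1 : ℝ)) false x + Literature.Analysis.FluidPDE.Torus.stokesMode (Pi.single (0 : Fin 3) (1 : ℤ)) (EuclideanSpace.single (1 : Fin 3) (1 : ℝ)) false x + Literature.Analysis.FluidPDE.Torus.stokesMode (Pi.single (1 : Fin 3) (1 : ℤ)) (EuclideanSpace.single (2 : Fin 3) (1 : ℝ)) false x : EuclideanSpace ℝ (Fin 3))), (fun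 x : UnitAddTorus (Fin 3) => (Literature.Analysis.FluidPDE.Torus.stokesMode (Pi.single (1 : Fin 3) (1 : ℤ)) (EuclideanSpace.single (0 : Fin 3) (1 : ℝ)) true x + Literature.Analysis.FluidPDE.Torus.stokesMode (Pi.single (2 : Fin 3) (1 : ℤ)) (EuclideanSpace.single (1 : Fin 3) (1 : ℝ)) true x + Literature.Analysis.FluidPDE.Torus.stokesMode (Pi.single (0 : Fin 3) (1 : ℤ)) (EuclideanSpace.single (2 : Fin 3) (1 : ℝ)) true x : EuclideanSpace ℝ (Fin 3))), (fun x : UnitAddTorus (Fin 3) => (Literature.Analysis.FluidPDE.Torus.stokesMode ![(0 : ℤ), 1, 1] (EuclideanSpace.single (0 : Fin 3) (1 : ℝ)) false x + Literature.Analysis.FluidPDE.Torus.stokesMode ![(1 : ℤ), 0, 1] (EuclideanSpace.single (1 : Fin 3) (1 : ℝ)) false x + Literature.Analysis.FluidPDE.Torus.stokesMode ![(1 : ℤ), 1, 0] (EuclideanSpace.single (2 : Fin 3) (1 : ℝ)) false x : EuclideanSpace ℝ (Fin 3)))] → ∀ E : ℝ, 0 < E → ∃ ν₁ η : ℝ,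 0 < ν₁ ∧ 0 < η ∧ ∀ c : EuclideanSpace ℝ (Fin 3), ‖c‖ = 1 → ∀ ν : ℝ, 0 < ν → ν < ν₁ → ∀ μ : MeasureTheory.Measure (Literature.Analysis.FunctionSpaces.Torus.energySpace (Fin 3)), Literature.Analysis.FluidPDE.Torus.IsStationaryStatisticalSolution ν (fun x : UnitAddTorus (Fin 3) => ∑ i : Fin 3, c i • b i x) μ → MeasureTheory.Integrable (fun u : Literature.Analysis.FunctionSpaces.Torus.energySpace (Fin 3) => ‖u‖ ^ 2) μ → Literature.Analysis.FluidPDE.Torus.ensembleEnergy μ ≤ E → η ≤ ∫ u, (∑ i : Fin 3, (Literature.Analysis.FluidPDE.Torus.pairing (u : MeasureTheory.Lp (EuclideanSpace ℝ (Fin 3)) 2 (MeasureTheory.volume : MeasureTheory.Measure (UnitAddTorus (Fin 3)))) (b i)) ^ 2) ∂μ := by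
  sorry

/-- **stub 2 — the stirred modes are coherent (no statistical reversal; the symmetry-breaking half; size XL,
open — the hardest stub).** For every energy level `E > 0` there are `ν₂, κ > 0` such that for every unit `c`,
every `ν ∈ (0, ν₂)` and every Foias–Prodi stationary statistical solution `μ` of `NS_ν(f_c)` with integrable
energy `≤ E`, the mean stirred-mode response captures a fixed fraction of the stirred-mode energy:
`κ · ∫ Σᵢ (u,bᵢ)² dμ ≤ Σᵢ (∫ (u,bᵢ) dμ)²` (order parameter `|⟨Y⟩|²/⟨|Y|²⟩ ≥ κ`). Why plausibly true: no
isometry of `T³` reverses `V = span(b₀,b₁,b₂)` while fixing a force of the sphere (route header, cheapest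
falsifier (a)), and the steady force accelerates the `c`-coordinate of `Y` at constant rate `‖f_c‖² = 3/2`, so
an incoherent (sign-symmetric) law of `Y` requires the transfer `b(u,u,f_c)` to beat a steady push symmetrically;
known steady-force reversals (periodic Kolmogorov flow, MusacchioBoffetta2014) flip transverse modes only. Why
it might fail: slow vacillation between two mirror-imbalanced large-scale states of equal weight in this
asymmetric geometry; mean energy bounds give no pointwise control of the transfer. Leans on: the stationary
Liouville identity (`IsStationaryStatisticalSolution.generator`) with cylindrical tests on `V`;
FMRTTurbulence2001 Ch. IV §1.2; MusacchioBoffetta2014; KanedaEtAl2003. -/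
theorem stub_stirredModesCoherent :
    ∀ b : Fin 3 → UnitAddTorus (Fin 3) → EuclideanSpace ℝ (Fin 3), b = ![(fun x : UnitAddTorus (Fin 3) => (Literature.Analysis.FluidPDE.Torus.stokesMode (Pi.single (2 : Fin 3) (1 : ℤ)) (EuclideanSpace.single (0 : Fin 3) (1 : ℝ)) false x + Literature.Analysis.FluidPDE.Torus.stokesMode (Pi.single (0 : Fin 3) (1 : ℤ)) (EuclideanSpace.single (1 : Fin 3) (1 : ℝ)) false x + Literature.Analysis.FluidPDE.Torus.stokesMode (Pi.single (1 : Fin 3) (1 : ℤ)) (EuclideanSpace.single (2 : Fin 3) (1 : ℝ)) false x : EuclideanSpace ℝ (Fin 3))), (fun x : UnitAddTorus (Fin 3) => (Literature.Analysis.FluidPDE.Torus.stokesMode (Pi.single (1 : Fin 3) (1 : ℤ)) (EuclideanSpace.single (0 : Fin 3) (1 : ℝ)) true x + Literature.Analysis.FluidPDE.Torus.stokesMode (Pi.single (2 : Fin 3) (1 : ℤ)) (EuclideanSpace.single (1 : Fin 3) (1 : ℝ)) true x + Literature.Analysis.FluidPDE.Torus.stokesMode (Pi.single (0 : Fin 3)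 (1 : ℤ)) (EuclideanSpace.single (2 : Fin 3) (1 : ℝ)) true x : EuclideanSpace ℝ (Fin 3))), (fun x : UnitAddTorus (Fin 3) => (Literature.Analysis.FluidPDE.Torus.stokesMode ![(0 : ℤ), 1, 1] (EuclideanSpace.single (0 : Fin 3) (1 : ℝ)) false x + Literature.Analysis.FluidPDE.Torus.stokesMode ![(1 : ℤ), 0, 1] (EuclideanSpace.single (1 : Fin 3) (1 : ℝ)) false x + Literature.Analysis.FluidPDE.Torus.stokesMode ![(1 : ℤ), 1, 0] (EuclideanSpace.single (2 : Fin 3) (1 : ℝ)) false x : EuclideanSpace ℝ (Fin 3)))] → ∀ E : ℝ, 0 < E → ∃ ν₂ κ : ℝ, 0 < ν₂ ∧ 0 < κ ∧ ∀ c : EuclideanSpace ℝ (Fin 3), ‖c‖ = 1 → ∀ ν : ℝ, 0 < ν → ν < ν₂ → ∀ μ : MeasureTheory.Measure (Literature.Analysis.FunctionSpaces.Torus.energySpace (Fin 3)), Literature.Analysis.FluidPDE.Torus.IsStationaryStatisticalSolution ν (fun x : UnitAddTorus (Fin 3) => ∑ i : Fin 3, c i • b i x) μ → MeasureTheory.Integrable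 (fun u : Literature.Analysis.FunctionSpaces.Torus.energySpace (Fin 3) => ‖u‖ ^ 2) μ → Literature.Analysis.FluidPDE.Torus.ensembleEnergy μ ≤ E → κ * (∫ u, (∑ i : Fin 3, (Literature.Analysis.FluidPDE.Torus.pairing (u : MeasureTheory.Lp (EuclideanSpace ℝ (Fin 3)) 2 (MeasureTheory.volume : MeasureTheory.Measure (UnitAddTorus (Fin 3)))) (b i)) ^ 2) ∂μ) ≤ ∑ i : Fin 3, (∫ u, Literature.Analysis.FluidPDE.Torus.pairing (u : MeasureTheory.Lp (EuclideanSpace ℝ (Fin 3)) 2 (MeasureTheory.volume : MeasureTheory.Measure (UnitAddTorus (Fin 3)))) (b i) ∂μ) ^ 2 := by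
  sorry

/-! ## Name-keyed aliases of the two stub statements — the hypotheses of `NoScreening_of`

The native skeleton audit (`#h21_check_skeleton`, run by `ledger skeleton check`) admits a hypothesis of the
composing theorem only if its head constant is a registered obligation or is NAMED like a declared stub;
`__Registered.stub_X` is the statement of `stub_X` verbatim under the stub's short name (device of
`Cruxes/GPLoudFamilyZ/Lines/birth.lean`, `Cruxes/MirrorFloorTG/Lines/birth.lean`). Each alias is an `abbrev`,
definitionally (and textually) its stub's signature — generated from the same source text. -/
namespace __Registered

/-- Alias of the statement of `stub_stirredModesEnergised` (the stirred modes stay energised), keyed by the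
stub name. -/
abbrev stub_stirredModesEnergised : Prop :=
  ∀ b : Fin 3 → UnitAddTorus (Fin 3) → EuclideanSpace ℝ (Fin 3), b = ![(fun x : UnitAddTorus (Fin 3) => (Literature.Analysis.FluidPDE.Torus.stokesMode (Pi.single (2 : Fin 3) (1 : ℤ)) (EuclideanSpace.single (0 : Fin 3) (1 : ℝ)) false x + Literature.Analysis.FluidPDE.Torus.stokesMode (Pi.single (0 : Fin 3) (1 : ℤ)) (EuclideanSpace.single (1 : Fin 3) (1 : ℝ)) false x + Literature.Analysis.FluidPDE.Torus.stokesMode (Pi.single (1 : Fin 3) (1 : ℤ)) (EuclideanSpace.single (2 : Fin 3) (1 : ℝ)) false x : EuclideanSpace ℝ (Fin 3))), (fun x : UnitAddTorus (Fin 3) => (Literature.Analysis.FluidPDE.Torus.stokesMode (Pi.single (1 : Fin 3) (1 : ℤ)) (EuclideanSpace.single (0 : Fin 3) (1 : ℝ)) true x + Literature.Analysis.FluidPDE.Torus.stokesMode (Pi.single (2 : Fin 3) (1 : ℤ)) (EuclideanSpace.single (1 : Fin 3) (1 : ℝ)) true x + Literature.Analysis.FluidPDE.Torus.stokesMode (Pi.single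 (0 : Fin 3) (1 : ℤ)) (EuclideanSpace.single (2 : Fin 3) (1 : ℝ)) true x : EuclideanSpace ℝ (Fin 3))), (fun x : UnitAddTorus (Fin 3) => (Literature.Analysis.FluidPDE.Torus.stokesMode ![(0 : ℤ), 1, 1] (EuclideanSpace.single (0 : Fin 3) (1 : ℝ)) false x + Literature.Analysis.FluidPDE.Torus.stokesMode ![(1 : ℤ), 0, 1] (EuclideanSpace.single (1 : Fin 3) (1 : ℝ)) false x + Literature.Analysis.FluidPDE.Torus.stokesMode ![(1 : ℤ), 1, 0] (EuclideanSpace.single (2 : Fin 3) (1 : ℝ)) false x : EuclideanSpace ℝ (Fin 3)))] → ∀ E : ℝ, 0 < E → ∃ ν₁ η : ℝ, 0 < ν₁ ∧ 0 < η ∧ ∀ c : EuclideanSpace ℝ (Fin 3), ‖c‖ = 1 → ∀ ν : ℝ, 0 < ν → ν < ν₁ → ∀ μ : MeasureTheory.Measure (Literature.Analysis.FunctionSpaces.Torus.energySpace (Fin 3)), Literature.Analysis.FluidPDE.Torus.IsStationaryStatisticalSolution ν (fun x : UnitAddTorus (Fin 3) => ∑ i : Fin 3, c i • b i x) μ → MeasureTheory.Integrable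 (fun u : Literature.Analysis.FunctionSpaces.Torus.energySpace (Fin 3) => ‖u‖ ^ 2) μ → Literature.Analysis.FluidPDE.Torus.ensembleEnergy μ ≤ E → η ≤ ∫ u, (∑ i : Fin 3, (Literature.Analysis.FluidPDE.Torus.pairing (u : MeasureTheory.Lp (EuclideanSpace ℝ (Fin 3)) 2 (MeasureTheory.volume : MeasureTheory.Measure (UnitAddTorus (Fin 3)))) (b i)) ^ 2) ∂μ

/-- Alias of the statement of `stub_stirredModesCoherent` (the stirred modes are coherent), keyed by the stub
name. -/
abbrev stub_stirredModesCoherent : Prop :=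
  ∀ b : Fin 3 → UnitAddTorus (Fin 3) → EuclideanSpace ℝ (Fin 3), b = ![(fun x : UnitAddTorus (Fin 3) => (Literature.Analysis.FluidPDE.Torus.stokesMode (Pi.single (2 : Fin 3) (1 : ℤ)) (EuclideanSpace.single (0 : Fin 3) (1 : ℝ)) false x + Literature.Analysis.FluidPDE.Torus.stokesMode (Pi.single (0 : Fin 3) (1 : ℤ)) (EuclideanSpace.single (1 : Fin 3) (1 : ℝ)) false x + Literature.Analysis.FluidPDE.Torus.stokesMode (Pi.single (1 : Fin 3) (1 : ℤ)) (EuclideanSpace.single (2 : Fin 3) (1 : ℝ)) false x : EuclideanSpace ℝ (Fin 3))), (fun x : UnitAddTorus (Fin 3) => (Literature.Analysis.FluidPDE.Torus.stokesMode (Pi.single (1 : Fin 3) (1 : ℤ)) (EuclideanSpace.single (0 : Fin 3) (1 : ℝ)) true x + Literature.Analysis.FluidPDE.Torus.stokesMode (Pi.single (2 : Fin 3) (1 : ℤ)) (EuclideanSpace.single (1 : Fin 3) (1 : ℝ)) true x + Literature.Analysis.FluidPDE.Torus.stokesMode (Pi.single (0 : Fin 3) (1 : ℤ)) (EuclideanSpace.single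 (2 : Fin 3) (1 : ℝ)) true x : EuclideanSpace ℝ (Fin 3))), (fun x : UnitAddTorus (Fin 3) => (Literature.Analysis.FluidPDE.Torus.stokesMode ![(0 : ℤ), 1, 1] (EuclideanSpace.single (0 : Fin 3) (1 : ℝ)) false x + Literature.Analysis.FluidPDE.Torus.stokesMode ![(1 : ℤ), 0, 1] (EuclideanSpace.single (1 : Fin 3) (1 : ℝ)) false x + Literature.Analysis.FluidPDE.Torus.stokesMode ![(1 : ℤ), 1, 0] (EuclideanSpace.single (2 : Fin 3) (1 : ℝ)) false x : EuclideanSpace ℝ (Fin 3)))] → ∀ E : ℝ, 0 < E → ∃ ν₂ κ : ℝ, 0 < ν₂ ∧ 0 < κ ∧ ∀ c : EuclideanSpace ℝ (Fin 3), ‖c‖ = 1 → ∀ ν : ℝ, 0 < ν → ν < ν₂ → ∀ μ : MeasureTheory.Measure (Literature.Analysis.FunctionSpaces.Torus.energySpace (Fin 3)), Literature.Analysis.FluidPDE.Torus.IsStationaryStatisticalSolution ν (fun x : UnitAddTorus (Fin 3) => ∑ i : Fin 3, c i • b i x) μ → MeasureTheory.Integrable (fun u : Literature.Analysis.FunctionSpaces.Torus.energySpace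 (Fin 3) => ‖u‖ ^ 2) μ → Literature.Analysis.FluidPDE.Torus.ensembleEnergy μ ≤ E → κ * (∫ u, (∑ i : Fin 3, (Literature.Analysis.FluidPDE.Torus.pairing (u : MeasureTheory.Lp (EuclideanSpace ℝ (Fin 3)) 2 (MeasureTheory.volume : MeasureTheory.Measure (UnitAddTorus (Fin 3)))) (b i)) ^ 2) ∂μ) ≤ ∑ i : Fin 3, (∫ u, Literature.Analysis.FluidPDE.Torus.pairing (u : MeasureTheory.Lp (EuclideanSpace ℝ (Fin 3)) 2 (MeasureTheory.volume : MeasureTheory.Measure (UnitAddTorus (Fin 3)))) (b i) ∂μ) ^ 2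

end __Registered

/-- **Composition** (kernel-checked, no `sorry` of its own): the two stub statements (as the name-keyed
aliases `__Registered.stub_*`) imply the crux
`Summit.AnomalousDissipation.AnomalousDissipation.Theses.StirringSphere.NoScreening` BY NAME.
`(ν₁, η)` from stub 1 and `(ν₂, κ)` from stub 2 at the level `E`; `ν₀ := min ν₁ ν₂`, `m₀ := √(κη) > 0`;
for a bounded stationary statistics at `ν < ν₀`: `m₀² = κη ≤ κ · ∫Σᵢ(u,bᵢ)² dμ ≤ Σᵢ (∫(u,bᵢ) dμ)²`.
[folklore] -/
theorem NoScreening_of :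
    __Registered.stub_stirredModesEnergised → __Registered.stub_stirredModesCoherent →
      Summit.AnomalousDissipation.AnomalousDissipation.Theses.StirringSphere.NoScreening := by
  intro h₁ h₂
  dsimp only [__Registered.stub_stirredModesEnergised, __Registered.stub_stirredModesCoherent] at h₁ h₂
  intro b hb E hE
  obtain ⟨ν₁, η, hν₁, hη, H₁⟩ := h₁ b hb E hE
  obtain ⟨ν₂, κ, hν₂, hκ, H₂⟩ := h₂ b hb E hE
  refine ⟨min ν₁ ν₂, Real.sqrt (κ * η), lt_min hν₁ hν₂, Real.sqrt_pos.2 (mul_pos hκ hη), ?_⟩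
  intro c hc ν hν hνlt μ hμ hint hEμ
  have he : η ≤ _ := H₁ c hc ν hν (lt_of_lt_of_le hνlt (min_le_left _ _)) μ hμ hint hEμ
  have hy : κ * _ ≤ _ := H₂ c hc ν hν (lt_of_lt_of_le hνlt (min_le_right _ _)) μ hμ hint hEμ
  rw [Real.sq_sqrt (mul_pos hκ hη).le]
  exact (mul_le_mul_of_nonneg_left he hκ.le).trans hy

/-- WIRING CHECK: the two sorried stubs compose to a closed term of the crux's type (modulo their `sorry`s).
Deliberately an `example` (no constant enters the environment), so that a BC3 probe importing this file could
not close `stub → NoScreening` by `exact?` through a pre-composed witness. -/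
example : Summit.AnomalousDissipation.AnomalousDissipation.Theses.StirringSphere.NoScreening :=
  NoScreening_of stub_stirredModesEnergised stub_stirredModesCoherent

end Summit.AnomalousDissipation.AnomalousDissipation.Cruxes.NoScreening.Birth

end
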